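import Literature.MathematicalPhysics.QuantumFieldTheory.Balaban1983to89.B15Prop1AxialGaugeSectionOfForest
import Literature.MathematicalPhysics.QuantumFieldTheory.Balaban1983to89.B15Prop1LocalChartFromThm1AtBase

/-!
# `Balaban1983to89.B15Prop1GaugeSectionOfForest` — [Balaban1985RegularSpaces] = «[6]», (1.19) p. 79 (the axial gauge `Ax_k(𝔅_k, U₀)`: «the conditions (1.19) determine uniquely an
# element in each orbit»); [Balaban1985Variational] = «[15]», (4) p. 278, (16)–(18) p. 280; [Balaban1985Averaging] (8) p. 18, (21) p. 21:
# THE RESIDUAL GAUGE SECTION (S) OF `B15Prop1LocalChartFromThm1AtBase` FROM A ROOTED FOREST — the path-holonomy gauge of dag-n12-w6's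
# `B15Prop1AxialGaugeSectionOfForest` carries every configuration near `U₀` CONTINUOUSLY into the slice chart `X ↦ exp(X)·U₀`, `X` in the axial slice of the forest, `X` near `0`

Honest framing: statement-level skeleton of published theorems with citation tags; proofs where landed; nothing here is a claim about the
Yang–Mills mass gap.  Cell `pub-ymgap`, HUMAN RULING D-0149 (width seats), seat `pub-ymgap-dag-n12-w1` (g3; N12 = [B15]; U1a⁺ of the w1 lineage, rule (ii)); `--kind proof
--supports` the K1 item of record; count-neutral; N12 NOT discharged; finite 𝕋⁴ at fixed ε; nothing continuum ∕ ℝ⁴ ∕ OS ∕ mass-gap ∕ Clay.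

WHY.  `B15Prop1LocalChartFromThm1AtBase.exists_localChart_at_baseField_of_thm1AtBase` displays, besides print's analysis, the letter (S): «for every neighbourhood `𝒪` of `0` in the
slice `S`, every configuration `U` near `U₀` has a RESIDUAL gauge translate `U^u` (`u = 1` at the block-tower sites of the constrained bonds, [15] (4)) with `↑(U^u) = exp(x)·↑U₀`,
`x ∈ 𝒪`».  dag-n12-w6's `B15Prop1AxialGaugeSectionOfForest` §1 supplies exactly the device: for a rooted forest `path` with (F1) prefix∕orientation, (F2) roots at the block-tower sites
of the constrained bonds, (F3) `S` = the axial slice of the forest, the PATH-HOLONOMY GAUGE `u_U(x) := 𝒰_{U₀}(path x)⁻¹·𝒰_U(path x)` is residual ((F2), `𝒰(∅) = 1`), satisfies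
`U^{u_U} = U₀` on the tree bonds ((F1), `gaugeAct_pathGauge_apply_of_last`) so that `X_U := (logCoordC(↑(U^{u_U} b)·↑U₀(b)⋆))_b ∈ S` ((F3), `log 1 = 0`), and `↑(U^{u_U})` is a
`C^∞` function of the bond matrices (`contDiff_pathGaugeAct`).  THIS FILE adds the two continuity facts the POINTWISE section needs — `X_U → 0` as `U → U₀` (`u_{U₀} = 1`,
`logCoordC` continuous at `1`) and `exp(X_U)·U₀ = U^{u_U}` near `U₀` (`expPointC ∘ logCoordC = id` on small `SL₂(ℂ)`, `B15SU2ChartHolomorphic.expPointC_logCoordC`) — and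
concludes (S); then the chart theorem with (S) DISCHARGED by the forest: per base field the displayed letters are `hcrit`, `honto`, (β) `hnondeg`, `hclass`, the class facts, (T1@q₀)
Theorem 1 at the base datum, (P8) Prop. 8 at chart points, and the CHOICE of print's comb `Ax_k(𝔅_k, U₀)` as a `path` datum with (F1)–(F3) (the same residual letter as dag-n12-w6's
`hcritT_curve_of_forest`).

CONTENTS (theorems only; no `def`, no `instance`, no `sorry`).  §1 `gaugeAct_const_one`, ★★ `gaugeSection_of_forest` ((S) ⟸ (F1)(F2)(F3)).  §2 ★★★
`exists_localChart_at_baseField_of_thm1AtBase_forest` (the chart theorem of `B15Prop1LocalChartFromThm1AtBase` with (S) discharged by the forest).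
HONEST SCOPE: kernel group algebra and continuity; nothing of Bałaban's asserted; (T1@q₀), (P8), `hcrit`, `honto`, `hnondeg`, the forest choice stay DISPLAYED; count-neutral; N12 NOT
discharged; the YM mass gap (Clay) is NOT proved by any of this — R4 closes only the conditional finite-𝕋⁴ rung `BalabanLadder.UV`.
-/

noncomputable section

namespace Literature.MathematicalPhysics.QuantumFieldTheory.Balaban1983to89.B15Prop1GaugeSectionOfForest

open Set Metric Filter
open scoped Topology
open Literature.MathematicalPhysics.QuantumFieldTheory.Balaban1983to89.Node00 (SU coeField coeField_apply SmallBelow ConstrSet constrCard constrEnum star_coe_mul_coe_SU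
  coe_mul_star_coe_SU holM contDiff_holM)
open B15AveragingHolomorphic (iterMh)
open B15ComplexifiedDatumFamily (conjVec)
open B15SU2ChartHolomorphic (expPointC expMulC logCoordC differentiableAt_logCoordC expPointC_logCoordC)
open B15Prop1DatumCoordinates (logCoordC_one)
open B15Prop1ClassOpenAtRecord (isInducing_coeField)
open B15Prop1AxialGaugeSectionOfForest (gaugeAct_pathGauge_apply_of_last pathGauge_eq_one_of_forall_mem contDiff_pathGaugeAct coe_gaugeAct_pathGauge)
open B15Prop1GaugeRetractionOfGaugeSection (det_coe_mul_star_coe)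
open B15Prop1LocalChartFromThm1AtBase (exists_localChart_at_baseField_of_thm1AtBase)
open B16Sect1Backgrounds (toMS)
open ExpMeanLog (expMeanLogSU)
open BlockAveraging (blockAvg)
open T4CubeChartGnomonic (SU2)
open T4Continuum B15DeterminingSets
open GaugeField hiding holAt
open scoped Matrix.Norms.L2Operator

variable {P : Params}

/-! ## §1  The pointwise residual gauge section of a rooted forest -/

section Section

/-- The trivial gauge transformation acts trivially: `U^{1} = U`. [cite: Balaban1985Averaging, (8) p.18 (bookkeeping)] -/
theorem gaugeAct_const_one (U : GaugeField P 0 SU2) : gaugeAct (fun _ => (1 : SU2)) U = U := by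
  funext b
  simp only [GaugeField.gaugeAct, one_mul, inv_one, mul_one]

/-- ★★ **THE RESIDUAL GAUGE SECTION (S) OF A ROOTED FOREST.**  For a base configuration `U₀`, a determining set `𝐁` read at levels `≤ k`, a slice `S` and a rooted forest `path` with
(F1) prefix∕orientation, (F2) roots at the block-tower sites of the constrained bonds, (F3) `S` = the axial slice of the forest: for every neighbourhood `𝒪` of `0` in `S`, every
configuration `U` near `U₀` has a residual gauge translate `U^u` (`u = 1` at the block-tower sites of the constrained bonds of levels `≤ k`) whose matrix field is `exp(x)·↑U₀` with
`x ∈ 𝒪` — witnessed by the path-holonomy gauge `u_U(x) := 𝒰_{U₀}(path x)⁻¹·𝒰_U(path x)` of [6] (1.19) and `x := (logCoordC(↑(U^{u_U} b)·↑U₀(b)⋆))_b`.  This is the letter (S) of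
`B15Prop1LocalChartFromThm1AtBase.hcritT_isMinimizer_of_thm1AtBase`. [cite: Balaban1985RegularSpaces, (1.19) p.79; Balaban1985Variational, (4) p.278, (16)–(18) p.280; Balaban1985Averaging, (8) p.18, (21) p.21] -/
theorem gaugeSection_of_forest (𝔹 : DetSet P) (k : ℕ) (U₀ : GaugeField P 0 SU2) (S : Submodule ℂ (VecField P 0 (EuclideanSpace ℂ (Fin 3))))
    -- DISPLAYED: the rooted forest by its root-to-site paths, with prefix∕orientation structure, roots and axial slice
    (path : Site P 0 → List (LStep P 0))
    (hF1 : ∀ x, ∀ s ∈ path x, ∃ x' x'' : Site P 0, path x'' = path x' ++ [s] ∧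
      (s.fwd = true → s.bond.src = x' ∧ s.bond.tgt = x'') ∧ (s.fwd = false → s.bond.src = x'' ∧ s.bond.tgt = x'))
    (hF2 : ∀ j, j ≤ k → ∀ c ∈ bondsOf (𝔹 j), path (embIter j c.src) = [] ∧ path (embIter j c.tgt) = [])
    (hF3 : ∀ X : VecField P 0 (EuclideanSpace ℂ (Fin 3)), X ∈ S ↔ ∀ x, ∀ s ∈ path x, X s.bond = 0) :
    ∀ 𝒪 ∈ 𝓝 (0 : S), ∀ᶠ U in 𝓝 U₀, ∃ u : GaugeTransf P 0 SU2, (∀ j, j ≤ k → ∀ b ∈ bondsOf (𝔹 j), toMS u j b.src = 1 ∧ toMS u j b.tgt = 1) ∧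
      ∃ x ∈ 𝒪, coeField (gaugeAct u U) = expMulC ((x : S) : VecField P 0 (EuclideanSpace ℂ (Fin 3))) (coeField U₀) := by
  intro 𝒪 h𝒪
  -- the gauge-fixed matrix field as a continuous function `M` of the bond matrices
  obtain ⟨M, hM⟩ : ∃ M : (PBond P 0 → Matrix (Fin 2) (Fin 2) ℂ) → PBond P 0 → Matrix (Fin 2) (Fin 2) ℂ,
      M = fun V b => star (holM (coeField U₀) (path b.src)) * holM V (path b.src) * V b *
        star (star (holM (coeField U₀) (path b.tgt)) * holM V (path b.tgt)) := ⟨_, rfl⟩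
  have hMc : Continuous M := by rw [hM]; exact (contDiff_pathGaugeAct path U₀).continuous
  have hMU : ∀ (U : GaugeField P 0 SU2) (b : PBond P 0),
      ((gaugeAct (fun x => (holAt U₀ (path x))⁻¹ * holAt U (path x)) U b : SU2) : Matrix (Fin 2) (Fin 2) ℂ) = M (coeField U) b := fun U b => by
    rw [hM]; exact coe_gaugeAct_pathGauge path U₀ U b
  have hσ₀ : (fun x => (holAt U₀ (path x))⁻¹ * holAt U₀ (path x)) = fun _ => (1 : SU2) := pathGauge_eq_one_of_forall_mem path fun _ _ _ => rfl
  have hM₀ : ∀ b, M (coeField U₀) b = ((U₀ b : SU2) : Matrix (Fin 2) (Fin 2) ℂ) := fun b => by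
    rw [← hMU U₀ b, hσ₀, gaugeAct_const_one]
  -- the logarithmic slice coordinates `L V b := logCoordC (M V b · ↑U₀(b)⋆)`
  obtain ⟨L, hL⟩ : ∃ L : (PBond P 0 → Matrix (Fin 2) (Fin 2) ℂ) → VecField P 0 (EuclideanSpace ℂ (Fin 3)),
      L = fun V b => logCoordC (M V b * star ((U₀ b : SU2) : Matrix (Fin 2) (Fin 2) ℂ)) := ⟨_, rfl⟩
  have hL₀ : L (coeField U₀) = 0 := by
    rw [hL]; funext b
    show logCoordC (M (coeField U₀) b * star ((U₀ b : SU2) : Matrix (Fin 2) (Fin 2) ℂ)) = 0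
    rw [hM₀, coe_mul_star_coe_SU, logCoordC_one]
  have hLc : ContinuousAt L (coeField U₀) := by
    rw [hL]
    refine continuousAt_pi.2 fun b => ?_
    have hin : ContinuousAt (fun V : PBond P 0 → Matrix (Fin 2) (Fin 2) ℂ => M V b * star ((U₀ b : SU2) : Matrix (Fin 2) (Fin 2) ℂ)) (coeField U₀) :=
      (((continuous_apply b).comp hMc).mul continuous_const).continuousAt
    have hone : M (coeField U₀) b * star ((U₀ b : SU2) : Matrix (Fin 2) (Fin 2) ℂ) = 1 := by rw [hM₀, coe_mul_star_coe_SU]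
    have hlog : ContinuousAt logCoordC (M (coeField U₀) b * star ((U₀ b : SU2) : Matrix (Fin 2) (Fin 2) ℂ)) := by
      rw [hone]; exact (differentiableAt_logCoordC (by rw [sub_self, norm_zero]; exact one_pos)).continuousAt
    exact ContinuousAt.comp_of_eq (g := logCoordC) hlog hin rfl
  -- (σ2): the coordinates lie in the slice, by the gauge condition on the tree and `log 1 = 0`
  have hLS : ∀ U : GaugeField P 0 SU2, L (coeField U) ∈ S := fun U => by
    refine (hF3 _).2 fun x s hs => ?_
    obtain ⟨x', x'', hp, hfwd, hbwd⟩ := hF1 x s hs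
    rw [hL]
    show logCoordC (M (coeField U) s.bond * star ((U₀ s.bond : SU2) : Matrix (Fin 2) (Fin 2) ℂ)) = 0
    rw [← hMU, gaugeAct_pathGauge_apply_of_last path U₀ U hp hfwd hbwd, coe_mul_star_coe_SU, logCoordC_one]
  -- near `↑U₀`: the relative matrices are within `1∕3` of `1`, and the coordinates lie in (the pull-back of) `𝒪`
  have hsmall : ∀ᶠ V in 𝓝 (coeField U₀), ∀ b : PBond P 0, ‖M V b * star ((U₀ b : SU2) : Matrix (Fin 2) (Fin 2) ℂ) - 1‖ < 1 / 3 := by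
    refine eventually_all.2 fun b => ?_
    have hin : ContinuousAt (fun V : PBond P 0 → Matrix (Fin 2) (Fin 2) ℂ => M V b * star ((U₀ b : SU2) : Matrix (Fin 2) (Fin 2) ℂ)) (coeField U₀) :=
      (((continuous_apply b).comp hMc).mul continuous_const).continuousAt
    have hball : Metric.ball (1 : Matrix (Fin 2) (Fin 2) ℂ) (1 / 3) ∈ 𝓝 (M (coeField U₀) b * star ((U₀ b : SU2) : Matrix (Fin 2) (Fin 2) ℂ)) := by
      rw [hM₀, coe_mul_star_coe_SU]; exact Metric.ball_mem_nhds _ (by norm_num)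
    filter_upwards [hin.preimage_mem_nhds hball] with V hV
    simpa only [mem_preimage, Metric.mem_ball, dist_eq_norm] using hV
  obtain ⟨T, hT, hTsub⟩ : ∃ T ∈ 𝓝 (0 : VecField P 0 (EuclideanSpace ℂ (Fin 3))), ∀ x : S, (x : VecField P 0 (EuclideanSpace ℂ (Fin 3))) ∈ T → x ∈ 𝒪 := by
    rw [Topology.IsInducing.subtypeVal.nhds_eq_comap, mem_comap] at h𝒪
    obtain ⟨T, hT, hsub⟩ := h𝒪
    exact ⟨T, by simpa only [Submodule.coe_zero] using hT, fun x hx => hsub hx⟩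
  have hLT : ∀ᶠ V in 𝓝 (coeField U₀), L V ∈ T := hLc.preimage_mem_nhds (by rw [hL₀]; exact hT)
  have hcoe : Continuous (coeField : GaugeField P 0 SU2 → PBond P 0 → Matrix (Fin 2) (Fin 2) ℂ) := isInducing_coeField.continuous
  filter_upwards [hcoe.continuousAt.eventually (hsmall.and hLT)] with U hU
  obtain ⟨hUsmall, hUT⟩ := hU
  refine ⟨fun x => (holAt U₀ (path x))⁻¹ * holAt U (path x), fun j hj b hb => ?_, ⟨L (coeField U), hLS U⟩, hTsub _ hUT, ?_⟩
  · -- residual at the roots (F2): `𝒰(∅) = 1`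
    obtain ⟨hs, ht⟩ := hF2 j hj b hb
    constructor
    · show (holAt U₀ (path (embIter j b.src)))⁻¹ * holAt U (path (embIter j b.src)) = 1
      rw [hs, holAt_nil, holAt_nil, inv_one, one_mul]
    · show (holAt U₀ (path (embIter j b.tgt)))⁻¹ * holAt U (path (embIter j b.tgt)) = 1
      rw [ht, holAt_nil, holAt_nil, inv_one, one_mul]
  · -- `exp ∘ log = id` on the small `SL₂(ℂ)` relative matrices
    funext b
    show ((gaugeAct (fun x => (holAt U₀ (path x))⁻¹ * holAt U (path x)) U b : SU2) : Matrix (Fin 2) (Fin 2) ℂ) =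
      expPointC (L (coeField U) b) * ((U₀ b : SU2) : Matrix (Fin 2) (Fin 2) ℂ)
    have hdet : (M (coeField U) b * star ((U₀ b : SU2) : Matrix (Fin 2) (Fin 2) ℂ)).det = 1 := by
      rw [← hMU]; exact det_coe_mul_star_coe _ _
    rw [hL]
    show _ = expPointC (logCoordC (M (coeField U) b * star ((U₀ b : SU2) : Matrix (Fin 2) (Fin 2) ℂ))) * _
    rw [expPointC_logCoordC (hUsmall b).le hdet, mul_assoc, star_coe_mul_coe_SU, mul_one, hMU]

end Section

/-! ## §2  The chart theorem with the gauge section DISCHARGED by the forest -/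

section Chart

/-- ★★★ **THE LOCAL HOLOMORPHIC MINIMISER CHART AT ONE BASE FIELD, ON THE AXIAL SLICE OF A ROOTED FOREST, FROM THEOREM 1 AT THE BASE DATUM.**
`B15Prop1LocalChartFromThm1AtBase.exists_localChart_at_baseField_of_thm1AtBase` with the slice `S` = the axial slice (F3) of a rooted forest `path` with (F1), (F2) — so that the
conjugation-stability of `S` and the residual gauge section (S) are THEOREMS (`gaugeSection_of_forest`) — leaving displayed, per base field: `hcrit`, `honto`, (β) `hnondeg`, `hclass`,
the class facts, (T1@q₀) Theorem 1 at the base datum, (P8) Prop. 8 at chart points, and the forest datum (print's comb `Ax_k(𝔅_k, U₀)`, [6] (1.19)). [cite: Balaban1985Variational, Thm 1 p.279, (4) p.278, (16)–(18) p.280, Sect. C (47)–(48) p.285, Sect. F p.300, Prop 8 p.305, Sect. G pp.305–307, Prop 9 (190) p.309; Balaban1985RegularSpaces, (1.19) p.79; Balaban1988Convergent, (2.10)–(2.12) p.256; Balaban1989LargeFieldI, Prop. 1 p.194 (last clause)] -/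
theorem exists_localChart_at_baseField_of_thm1AtBase_forest (𝔹 : DetSet P) (k : ℕ) (hk : k ≤ P.m + P.K) (h𝔹 : ∀ j, k < j → 𝔹 j = ∅) (reg : Set (GaugeField P 0 SU2))
    {Q₀ U₀ : GaugeField P 0 SU2}
    (hsbQ : SmallBelow (fun j => blockAvg (P := P) (j := j) expMeanLogSU) k Q₀)
    (hsbU : SmallBelow (fun j => blockAvg (P := P) (j := j) expMeanLogSU) k U₀)
    (hU₀ : AgreeOn 𝔹 (avgFamily (fun j => blockAvg (P := P) (j := j) expMeanLogSU) U₀) (avgFamily (fun j => blockAvg (P := P) (j := j) expMeanLogSU) Q₀))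
    -- the gauge slice = the axial slice of a rooted forest (F3), with (F1) prefix∕orientation and (F2) roots at the block towers of the constrained bonds
    (S : Submodule ℂ (VecField P 0 (EuclideanSpace ℂ (Fin 3))))
    (path : Site P 0 → List (LStep P 0))
    (hF1 : ∀ x, ∀ s ∈ path x, ∃ x' x'' : Site P 0, path x'' = path x' ++ [s] ∧
      (s.fwd = true → s.bond.src = x' ∧ s.bond.tgt = x'') ∧ (s.fwd = false → s.bond.src = x'' ∧ s.bond.tgt = x'))
    (hF2 : ∀ j, j ≤ k → ∀ c ∈ bondsOf (𝔹 j), path (embIter j c.src) = [] ∧ path (embIter j c.tgt) = [])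
    (hF3 : ∀ X : VecField P 0 (EuclideanSpace ℂ (Fin 3)), X ∈ S ↔ ∀ x, ∀ s ∈ path x, X s.bond = 0)
    -- the action and the constraint coordinates on the slice, characterised pointwise
    (a : S → ℂ)
    (ha : ∀ X : S, a X = ∑ p : Plaq P 0, (1 - (expMulC (X : VecField P 0 (EuclideanSpace ℂ (Fin 3))) (coeField U₀) ⟨p.src, p.μ⟩ *
      expMulC (X : VecField P 0 (EuclideanSpace ℂ (Fin 3))) (coeField U₀) ⟨p.src.shift p.μ, p.ν⟩ *
      Matrix.adjugate (expMulC (X : VecField P 0 (EuclideanSpace ℂ (Fin 3))) (coeField U₀) ⟨p.src.shift p.ν, p.μ⟩) *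
      Matrix.adjugate (expMulC (X : VecField P 0 (EuclideanSpace ℂ (Fin 3))) (coeField U₀) ⟨p.src, p.ν⟩)).trace / 2))
    (Φ₀ : S → Fin (constrCard 𝔹 k) → EuclideanSpace ℂ (Fin 3))
    (hΦ₀ : ∀ (X : S) i, Φ₀ X i = logCoordC (star ((avgFamily (fun j => blockAvg (P := P) (j := j) expMeanLogSU) Q₀ ((constrEnum 𝔹 k).symm i).1
      ((constrEnum 𝔹 k).symm i).2.1 : SU2) : Matrix (Fin 2) (Fin 2) ℂ) *
      iterMh ((constrEnum 𝔹 k).symm i).1 (expMulC (X : VecField P 0 (EuclideanSpace ℂ (Fin 3))) (coeField U₀)) ((constrEnum 𝔹 k).symm i).2.1))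
    -- DISPLAYED: Lagrange criticality of the base state, «onto», (β) nondegeneracy — in these coordinates
    {ℓ₀ : (Fin (constrCard 𝔹 k) → EuclideanSpace ℂ (Fin 3)) →L[ℂ] ℂ}
    (hcrit : fderiv ℂ a 0 = ℓ₀.comp (fderiv ℂ Φ₀ 0))
    (honto : Function.Surjective (fderiv ℂ Φ₀ 0))
    (hnondeg : ∀ s : S, fderiv ℂ Φ₀ 0 s = 0 →
      (∀ t : S, fderiv ℂ Φ₀ 0 t = 0 → fderiv ℂ (fderiv ℂ a) 0 s t - ℓ₀ (fderiv ℂ (fderiv ℂ Φ₀) 0 s t) = 0) → s = 0)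
    -- DISPLAYED: the class is open at `U₀`; criticality transfer; [15] Thm 1's uniqueness clause
    (hclass : ∀ᶠ Q in 𝓝 (coeField U₀), ∀ U' : GaugeField P 0 SU2, coeField U' = Q → U' ∈ reg)
    -- the three CLASS facts: the closed-reading class `reg'`
    (reg' : Set (GaugeField P 0 SU2)) (hreg' : IsClosed reg') (hcl : closure reg ⊆ reg')
    (hreg'sb : ∀ U ∈ reg', SmallBelow (fun j => blockAvg (P := P) (j := j) expMeanLogSU) k U)
    -- DISPLAYED (T1@q₀): Theorem 1 at the base datum — the residual orbit of `U₀` is the unique minimal orbit over `reg'`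
    (hT1 : ∀ U ∈ reg', AgreeOn 𝔹 (avgFamily (fun j => blockAvg (P := P) (j := j) expMeanLogSU) U) (avgFamily (fun j => blockAvg (P := P) (j := j) expMeanLogSU) Q₀) →
      wilsonAction4 U ≤ wilsonAction4 U₀ →
        ∃ u : GaugeTransf P 0 SU2, (∀ j, j ≤ k → ∀ b ∈ bondsOf (𝔹 j), toMS u j b.src = 1 ∧ toMS u j b.tgt = 1) ∧ gaugeAct u U = U₀)
    -- DISPLAYED (P8): a minimiser over `reg` at a chart point near `0` is Lagrange-critical in the slice coordinates
    (hP8 : ∀ᶠ x in 𝓝 (0 : S), ∀ U' : GaugeField P 0 SU2, expMulC ((x : S) : VecField P 0 (EuclideanSpace ℂ (Fin 3))) (coeField U₀) = coeField U' →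
      IsMinimizer (fun j => blockAvg (P := P) (j := j) expMeanLogSU) reg 𝔹 (avgFamily (fun j => blockAvg (P := P) (j := j) expMeanLogSU) U') U' →
        ∃ μ : (Fin (constrCard 𝔹 k) → EuclideanSpace ℂ (Fin 3)) →L[ℂ] ℂ, fderiv ℂ a x = μ.comp (fderiv ℂ Φ₀ x))
    {𝓐₀ : ℝ} (h𝓐₀ : 1 < 𝓐₀) :
    ∃ O : Set (PBond P 0 → Matrix (Fin 2) (Fin 2) ℂ), IsOpen O ∧ coeField Q₀ ∈ O ∧
      ∃ Γ : (PBond P 0 → Matrix (Fin 2) (Fin 2) ℂ) → PBond P 0 → Matrix (Fin 2) (Fin 2) ℂ,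
        (∀ b i j, DifferentiableOn ℂ (fun Q => Γ Q b i j) O) ∧
        (∀ Q ∈ O, ∀ b i j, ‖Γ Q b i j‖ ≤ 𝓐₀) ∧
        ∀ Q' : GaugeField P 0 SU2, coeField Q' ∈ O →
          ∃ U' : GaugeField P 0 SU2, (∀ b, Γ (coeField Q') b = ((U' b : SU2) : Matrix (Fin 2) (Fin 2) ℂ)) ∧
            IsMinimizer (fun j => blockAvg (P := P) (j := j) expMeanLogSU) reg 𝔹 (avgFamily (fun j => blockAvg (P := P) (j := j) expMeanLogSU) Q') U' :=
  exists_localChart_at_baseField_of_thm1AtBase 𝔹 k hk h𝔹 reg hsbQ hsbU hU₀ S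
    (fun X hX => (hF3 _).2 fun x s hs => by
      have h0 : X s.bond = 0 := (hF3 X).1 hX x s hs
      ext a
      simp [conjVec, h0])
    a ha Φ₀ hΦ₀ hcrit honto hnondeg hclass reg' hreg' hcl hreg'sb hT1 (gaugeSection_of_forest 𝔹 k U₀ S path hF1 hF2 hF3) hP8 h𝓐₀

end Chart


end Literature.MathematicalPhysics.QuantumFieldTheory.Balaban1983to89.B15Prop1GaugeSectionOfForest

end
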